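import Mathlib.Analysis.Calculus.FDeriv.Symmetric
import Mathlib.Analysis.InnerProductSpace.Calculus
import Mathlib.Analysis.Calculus.ContDiff.Operations
import Mathlib.Analysis.Calculus.ContDiff.Deriv
import Mathlib.Analysis.Calculus.Deriv.Comp
import HarnessLib

/-!
# The flat Levi form of `‖h‖²` for a Cauchy–Riemann map `h`, and of radial profiles `Θ(‖L·‖²)`

Topic `Literature/Geometry/Symplectic`; a proofs-only file (no definitions, no named facts) in
the flat formalism of `SteinOneHandlebodies.lean`, §2–4: for a constant complex structure `J₀` of
a real vector space `E` the **flat Levi form** of a function `Ψ : E → ℝ` of class `C²` is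
`L_Ψ(u) = D²Ψ(u, u) + D²Ψ(J₀u, J₀u)` (`= -dd^ℂΨ(u, J₀u)`, `neg_extDeriv_dComplexFlat_self`), and
`Ψ` is strictly `J₀`-plurisubharmonic iff `L_Ψ(u) > 0` for `u ≠ 0` — the inequality which
`SteinOneHandlebodies.neg_mextDeriv_dComplex_sublevel_self` turns into the field `convex` of a
`SteinStructure` on a regular sublevel set `{Ψ ≤ c} ⊂ ℝ⁴`.  This file computes `L_Ψ` for the two
building blocks of explicit plurisubharmonic functions on `ℂ² = ℝ⁴` (Cieliebak–Eliashberg 2012,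
Ch. 2: *"`|f|²` for holomorphic `f`"*, *"`φ(|z|²)` with `φ` convex increasing"*):

* `fderiv_fderiv_norm_sq_apply_of_contDiffAt` — `D²(‖h‖²)(u, v) = 2⟨Dh u, Dh v⟩ + 2⟨h, D²h(u, v)⟩`
  for `h : E → G` of class `C²`, `G` a real inner product space;
* `fderiv_fderiv_apply_J_of_cauchyRiemann`, `fderiv_fderiv_J_J_of_cauchyRiemann` — for
  `h : E → ℂ` of class `C²` satisfying the Cauchy–Riemann identity `Dh(J₀u) = i Dh(u)`
  everywhere, `D²h(v)(J₀u) = i D²h(v)(u)` and `D²h(J₀u, J₀u) = -D²h(u, u)` (differentiate the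
  identity; symmetry of `D²h`);
* `levi_norm_sq_of_cauchyRiemann` — **`L_{‖h‖²}(u) = 4‖Dh u‖²`** (so `‖h‖²` is
  plurisubharmonic, strictly in the directions not killed by `Dh`);
* `fderiv_fderiv_comp_norm_sq_apply`, `levi_comp_norm_sq_of_linear` — for a real-linear
  `L : E →L[ℝ] ℂ` intertwining `J₀` with `i` (`L(J₀u) = i L(u)`) and `Θ : ℝ → ℝ` of class `C²`,
  **`L_{Θ(‖L·‖²)}(u) = 4 (Θ'(s) + s Θ''(s)) ‖L u‖²`**, `s = ‖L z‖²` (so `Θ(‖x‖²)` is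
  plurisubharmonic when `Θ' + sΘ'' ≥ 0`, e.g. `Θ` convex and non-decreasing).

Use: the strictly pseudoconvex model `{‖w‖² + Θ(‖x‖²) + ε‖x‖² + ε'χ(‖y‖²)‖y‖² ≤ 1/4}` of the
Lefschetz base (`LefschetzBaseProfileChange.lean`, `LefschetzBaseRounding.lean`; base case of
`palf_stein_supportedByBoundaryOpenBook`).

## References

* K. Cieliebak, Ya. Eliashberg, *From Stein to Weinstein and Back*, AMS Coll. Publ. 59 (2012),
  Ch. 2 (`J`-convex functions; examples `|f|²`, `φ(|z|²)`). [CieliebakEliashberg2012]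
* L. Hörmander, *An Introduction to Complex Analysis in Several Variables*, 3rd ed. (1990),
  §2.6 (plurisubharmonic functions, the Levi form). [Hormander1990]
-/

noncomputable section

open scoped Topology ContDiff RealInnerProductSpace ComplexConjugate
open Complex

namespace Literature.Geometry.Symplectic

variable {E : Type*} [NormedAddCommGroup E] [NormedSpace ℝ E]

/-! ### The Hessian of `‖h‖²` -/

section NormSq

variable {G : Type*} [NormedAddCommGroup G] [InnerProductSpace ℝ G]

/-- **`D²(‖h‖²)(z)(u, v) = 2⟨Dh(z)u, Dh(z)v⟩ + 2⟨h(z), D²h(z)(u, v)⟩`** for `h` of class `C²`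
near `z` (any real normed domain, real inner product target). [folklore] -/
theorem fderiv_fderiv_norm_sq_apply_of_contDiffAt {h : E → G} {z : E} (hh : ContDiffAt ℝ 2 h z)
    (u v : E) :
    fderiv ℝ (fderiv ℝ fun y => ‖h y‖ ^ 2) z u v =
      2 * ⟪fderiv ℝ h z u, fderiv ℝ h z v⟫ + 2 * ⟪h z, fderiv ℝ (fderiv ℝ h) z u v⟫ := by
  have hhd : ∀ᶠ y in 𝓝 z, DifferentiableAt ℝ h y := by
    filter_upwards [hh.eventually (by simp)] with y hy
    exact hy.differentiableAt two_ne_zero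
  have h1 : fderiv ℝ (fun y => ‖h y‖ ^ 2) =ᶠ[𝓝 z]
      fun y => (2 : ℝ) • (innerSL ℝ (h y)).comp (fderiv ℝ h y) := by
    filter_upwards [hhd] with y hy
    rw [hy.hasFDerivAt.norm_sq.fderiv, two_smul, two_smul]
  rw [h1.fderiv_eq]
  have hd : DifferentiableAt ℝ (fderiv ℝ h) z :=
    (hh.fderiv_right (m := 1) (by norm_num)).differentiableAt one_ne_zero
  have hhz : DifferentiableAt ℝ h z := hh.differentiableAt two_ne_zero
  have hc : HasFDerivAt (fun y => innerSL ℝ (h y))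
      ((innerSL ℝ : G →L[ℝ] G →L[ℝ] ℝ).comp (fderiv ℝ h z)) z :=
    (innerSL ℝ : G →L[ℝ] G →L[ℝ] ℝ).hasFDerivAt.comp z hhz.hasFDerivAt
  rw [fderiv_fun_const_smul (hc.differentiableAt.clm_comp hd),
    fderiv_clm_comp hc.differentiableAt hd, hc.fderiv]
  simp only [FunLike.coe_smul, Pi.smul_apply, _root_.add_apply,
    ContinuousLinearMap.comp_apply, ContinuousLinearMap.compL_apply,
    ContinuousLinearMap.flip_apply, innerSL_apply_apply, smul_eq_mul]
  ring

end NormSq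

/-! ### Second-order Cauchy–Riemann identities -/

section CR

variable (J₀ : E →L[ℝ] E) {h : E → ℂ}

/-- **First consequence of the Cauchy–Riemann identity for the second derivative**: if
`Dh(y)(J₀u) = i Dh(y)(u)` for all `y, u` and `h` is of class `C²`, then
`D²h(z)(v)(J₀u) = i D²h(z)(v)(u)` (differentiate `y ↦ Dh(y)(J₀u) = i Dh(y)(u)` in the direction
`v`). [folklore] -/
theorem fderiv_fderiv_apply_J_of_cauchyRiemann (hh : ContDiff ℝ 2 h)
    (hCR : ∀ y u, fderiv ℝ h y (J₀ u) = I * fderiv ℝ h y u) (z u v : E) :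
    fderiv ℝ (fderiv ℝ h) z v (J₀ u) = I * fderiv ℝ (fderiv ℝ h) z v u := by
  have hd : DifferentiableAt ℝ (fderiv ℝ h) z :=
    ((hh.contDiffAt (x := z)).fderiv_right (m := 1) (by norm_num)).differentiableAt one_ne_zero
  -- both sides as derivatives of `y ↦ Dh(y)(·)` in the direction `v`
  have h1 : fderiv ℝ (fun y => fderiv ℝ h y (J₀ u)) z v = fderiv ℝ (fderiv ℝ h) z v (J₀ u) := by
    rw [fderiv_clm_apply hd (differentiableAt_const _)]
    simp
  have h2 : fderiv ℝ (fun y => I * fderiv ℝ h y u) z v = I * fderiv ℝ (fderiv ℝ h) z v u := by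
    have hdu : DifferentiableAt ℝ (fun y => fderiv ℝ h y u) z := hd.clm_apply (differentiableAt_const _)
    rw [fderiv_const_mul hdu, FunLike.coe_smul, Pi.smul_apply,
      fderiv_clm_apply hd (differentiableAt_const _)]
    simp [smul_eq_mul]
  have hfun : (fun y => fderiv ℝ h y (J₀ u)) = fun y => I * fderiv ℝ h y u := funext fun y => hCR y u
  rw [← h1, hfun, h2]

/-- **`D²h(J₀u, J₀u) = -D²h(u, u)`** for a Cauchy–Riemann map of class `C²` (apply the previous
identity twice, with the symmetry of the second derivative in between). [folklore] -/
theorem fderiv_fderiv_J_J_of_cauchyRiemann (hh : ContDiff ℝ 2 h)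
    (hCR : ∀ y u, fderiv ℝ h y (J₀ u) = I * fderiv ℝ h y u) (z u : E) :
    fderiv ℝ (fderiv ℝ h) z (J₀ u) (J₀ u) = -fderiv ℝ (fderiv ℝ h) z u u := by
  have hsymm : fderiv ℝ (fderiv ℝ h) z (J₀ u) u = fderiv ℝ (fderiv ℝ h) z u (J₀ u) :=
    (hh.contDiffAt (x := z)).isSymmSndFDerivAt (by simp) (J₀ u) u
  rw [fderiv_fderiv_apply_J_of_cauchyRiemann J₀ hh hCR z u (J₀ u), hsymm,
    fderiv_fderiv_apply_J_of_cauchyRiemann J₀ hh hCR z u u, ← mul_assoc, I_mul_I]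
  ring

/-- **The flat Levi form of `‖h‖²` for a Cauchy–Riemann map**: if `h : E → ℂ` is of class `C²`
and `Dh(J₀u) = i Dh(u)` everywhere, then
`D²(‖h‖²)(u, u) + D²(‖h‖²)(J₀u, J₀u) = 4 ‖Dh(z) u‖²` — `‖h‖²` is `J₀`-plurisubharmonic.
(Cieliebak–Eliashberg 2012, Ch. 2: `|f|²` is `i`-convex where `df ≠ 0`.) [folklore] -/
theorem levi_norm_sq_of_cauchyRiemann (hh : ContDiff ℝ 2 h)
    (hCR : ∀ y u, fderiv ℝ h y (J₀ u) = I * fderiv ℝ h y u) (z u : E) :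
    fderiv ℝ (fderiv ℝ fun y => ‖h y‖ ^ 2) z u u +
        fderiv ℝ (fderiv ℝ fun y => ‖h y‖ ^ 2) z (J₀ u) (J₀ u) =
      4 * ‖fderiv ℝ h z u‖ ^ 2 := by
  have hz : ContDiffAt ℝ 2 h z := hh.contDiffAt
  rw [fderiv_fderiv_norm_sq_apply_of_contDiffAt hz, fderiv_fderiv_norm_sq_apply_of_contDiffAt hz,
    fderiv_fderiv_J_J_of_cauchyRiemann J₀ hh hCR z u, hCR z u, inner_neg_right,
    real_inner_self_eq_norm_sq, real_inner_self_eq_norm_sq, norm_mul, Complex.norm_I, one_mul]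
  ring

end CR

/-! ### Radial profiles `Θ(‖L·‖²)` of a complex-linear functional -/

section Radial

variable (J₀ : E →L[ℝ] E) (L : E →L[ℝ] ℂ) {Θ : ℝ → ℝ}

/-- `y ↦ ‖L y‖²` has derivative `2⟨L y, L ·⟩`. [folklore] -/
theorem hasFDerivAt_norm_sq_clm (y : E) :
    HasFDerivAt (fun y => ‖L y‖ ^ 2) ((2 : ℝ) • (innerSL ℝ (L y)).comp L) y := by
  have h := (L.hasFDerivAt (x := y)).norm_sq
  rwa [two_smul, ← two_smul ℝ] at h

/-- The first derivative of `Θ(‖L·‖²)`: `D(Θ ∘ s)(y) = Θ'(s y) · 2⟨L y, L ·⟩`. [folklore] -/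
theorem hasFDerivAt_comp_norm_sq (hΘ : Differentiable ℝ Θ) (y : E) :
    HasFDerivAt (fun y => Θ (‖L y‖ ^ 2))
      (deriv Θ (‖L y‖ ^ 2) • ((2 : ℝ) • (innerSL ℝ (L y)).comp L)) y :=
  ((hΘ _).hasDerivAt).comp_hasFDerivAt y (hasFDerivAt_norm_sq_clm L y)

/-- **The Hessian of a radial profile**: for `Θ` of class `C²`,
`D²(Θ(‖L·‖²))(z)(u, v) = Θ''(s) (2⟨Lz, Lu⟩)(2⟨Lz, Lv⟩) + Θ'(s) 2⟨Lu, Lv⟩`, `s = ‖L z‖²`.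
[folklore] -/
theorem fderiv_fderiv_comp_norm_sq_apply (hΘ : ContDiff ℝ 2 Θ) (z u v : E) :
    fderiv ℝ (fderiv ℝ fun y => Θ (‖L y‖ ^ 2)) z u v =
      deriv (deriv Θ) (‖L z‖ ^ 2) * (2 * ⟪L z, L u⟫) * (2 * ⟪L z, L v⟫) +
        deriv Θ (‖L z‖ ^ 2) * (2 * ⟪L u, L v⟫) := by
  have hΘd : Differentiable ℝ Θ := hΘ.differentiable (by norm_num)
  have hΘ1 : ContDiff ℝ 1 (deriv Θ) := (contDiff_succ_iff_deriv.1 hΘ).2.2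
  have hΘ'd : Differentiable ℝ (deriv Θ) := hΘ1.differentiable (by norm_num)
  -- the first derivative as a function
  set S : E → ℝ := fun y => ‖L y‖ ^ 2 with hS
  set M : E → (E →L[ℝ] ℝ) := fun y => (2 : ℝ) • (innerSL ℝ (L y)).comp L with hM
  have hfd : fderiv ℝ (fun y => Θ (‖L y‖ ^ 2)) = fun y => deriv Θ (S y) • M y :=
    funext fun y => (hasFDerivAt_comp_norm_sq L hΘd y).fderiv
  rw [hfd]
  -- derivative of `y ↦ Θ'(S y)`
  have hg : HasFDerivAt (fun y => deriv Θ (S y)) (deriv (deriv Θ) (S z) • M z) z :=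
    ((hΘ'd _).hasDerivAt).comp_hasFDerivAt z (hasFDerivAt_norm_sq_clm L z)
  -- derivative of `M`
  have hM' : HasFDerivAt M ((2 : ℝ) • ((ContinuousLinearMap.compL ℝ E ℂ ℝ).flip L).comp
      ((innerSL ℝ : ℂ →L[ℝ] ℂ →L[ℝ] ℝ).comp L)) z := by
    have h1 : HasFDerivAt (fun y => innerSL ℝ (L y)) ((innerSL ℝ : ℂ →L[ℝ] ℂ →L[ℝ] ℝ).comp L) z :=
      (innerSL ℝ : ℂ →L[ℝ] ℂ →L[ℝ] ℝ).hasFDerivAt.comp z (L.hasFDerivAt (x := z))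
    have h2 : HasFDerivAt (fun y => (innerSL ℝ (L y)).comp L)
        (((ContinuousLinearMap.compL ℝ E ℂ ℝ).flip L).comp ((innerSL ℝ : ℂ →L[ℝ] ℂ →L[ℝ] ℝ).comp L)) z :=
      ((ContinuousLinearMap.compL ℝ E ℂ ℝ).flip L).hasFDerivAt.comp z h1
    exact h2.const_smul (2 : ℝ)
  have hprod := hg.smul hM'
  rw [show (fun y => deriv Θ (S y) • M y) = (fun y => deriv Θ (S y)) • M from rfl, hprod.fderiv]
  simp only [hM, _root_.add_apply, _root_.smul_apply,
    ContinuousLinearMap.comp_apply, ContinuousLinearMap.flip_apply,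
    ContinuousLinearMap.compL_apply, innerSL_apply_apply, smul_eq_mul,
    ContinuousLinearMap.smulRight_apply]
  ring

/-- For a functional intertwining `J₀` with `i`: `⟨Lz, Lu⟩² + ⟨Lz, L(J₀u)⟩² = ‖Lz‖² ‖Lu‖²`
(`Re² + Im²` of `conj(Lz) · Lu`). [folklore] -/
theorem inner_sq_add_inner_J_sq (hL : ∀ u, L (J₀ u) = I * L u) (z u : E) :
    ⟪L z, L u⟫ ^ 2 + ⟪L z, L (J₀ u)⟫ ^ 2 = ‖L z‖ ^ 2 * ‖L u‖ ^ 2 := by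
  rw [hL, Complex.inner, Complex.inner, Complex.sq_norm, Complex.sq_norm, Complex.normSq_apply,
    Complex.normSq_apply]
  simp only [Complex.mul_re, Complex.mul_im, Complex.conj_re, Complex.conj_im, Complex.I_re,
    Complex.I_im]
  ring

/-- **The flat Levi form of a radial profile**: for `L : E →L[ℝ] ℂ` with `L(J₀u) = i L(u)` and
`Θ` of class `C²`,
`D²(Θ(‖L·‖²))(u, u) + D²(Θ(‖L·‖²))(J₀u, J₀u) = 4 (Θ'(s) + s Θ''(s)) ‖L u‖²`, `s = ‖L z‖²`
(Cieliebak–Eliashberg 2012, Ch. 2: `φ(|z|²)` is `i`-convex for `φ` convex increasing; in one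
complex variable `∂∂̄ φ(|z|²) = (φ' + |z|²φ'') dz ∧ dz̄`). [folklore] -/
theorem levi_comp_norm_sq_of_linear (hL : ∀ u, L (J₀ u) = I * L u) (hΘ : ContDiff ℝ 2 Θ)
    (z u : E) :
    fderiv ℝ (fderiv ℝ fun y => Θ (‖L y‖ ^ 2)) z u u +
        fderiv ℝ (fderiv ℝ fun y => Θ (‖L y‖ ^ 2)) z (J₀ u) (J₀ u) =
      4 * (deriv Θ (‖L z‖ ^ 2) + ‖L z‖ ^ 2 * deriv (deriv Θ) (‖L z‖ ^ 2)) * ‖L u‖ ^ 2 := by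
  rw [fderiv_fderiv_comp_norm_sq_apply L hΘ, fderiv_fderiv_comp_norm_sq_apply L hΘ]
  have h1 := inner_sq_add_inner_J_sq J₀ L hL z u
  have h2 : ⟪L (J₀ u), L (J₀ u)⟫ = ‖L u‖ ^ 2 := by
    rw [real_inner_self_eq_norm_sq, hL, norm_mul, Complex.norm_I, one_mul]
  have h3 : ⟪L u, L u⟫ = ‖L u‖ ^ 2 := real_inner_self_eq_norm_sq _
  rw [h2, h3]
  linear_combination (4 * deriv (deriv Θ) (‖L z‖ ^ 2)) * h1

end Radial

end Literature.Geometry.Symplectic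

end
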